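import Literature.NumberTheory.LFunctions.YoshidaWindowGramFrontDoorW
import HarnessLib

/-!
# Kernel enclosures of Yoshida's matrix coefficients — VII-a: the order-`J` tail matrices as real functions

Source: H. Yoshida, Adv. Stud. Pure Math. **21** (1992) 281–325, §§6–7 [Yoshida1992HermitianForms]: the finite
certificate of Weil positivity on a window `[−a, a]` controls the far coupling columns `b_m = (M^σ(i,m))_{i<B}`,
`m ≥ B₃`, by a majorant `U₂ ⪰ Σ_{m≥B₃} b_m b_mᵀ/d̂_m`.  The ORDER-`J` data front door
(`WeilFormatC.weilPositivityOn_of_formatC_dataJ`, rh-explicit weil-10, 2026-08-22) takes for `U₂` the explicit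
`B × B` matrices `U₂⁺ = c_A·V_AẐ_AV_Aᵀ + c_B·V_BẐ_BV_Bᵀ + c_R·diag(ρ²)` (even sector) and the odd analogue — two
rank-`J` Hankel Gram terms of zeta tails plus a diagonal remainder, Peter–Paul parameters `θ, η > 0`.  This file
transcribes them VERBATIM as real functions on `ℕ × ℕ` (`Encl.U2EvenJ`, `Encl.U2OddJ`), proves the bridges to the
door's inline `Fin`-indexed expressions (`U2EvenJ_fin`, `U2OddJ_fin`), and gives structured forms over named atoms
(`C_F`, `C_A^±`, `q = a²/4π²`, `s²`, the mode function `F_n`, the Hankel entries) with `U2EvenJ'_eq`, `U2OddJ'_eq` —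
the shape the kernel boxes of part VII-b follow.  Everything is proved; no named facts.
-/

open Real Complex Finset Matrix
open scoped BigOperators

namespace Literature.NumberTheory.LFunctions.Yoshida1992

open Literature.Analysis.SpecialFunctions Literature.Analysis.ValidatedNumerics.NumericsMP
open Literature.Analysis.ValidatedNumerics
open scoped ArithmeticFunction.vonMangoldt

namespace Encl

variable {a : ℝ}

/-! ## The order-`J` tail matrices as real functions (verbatim sub-expressions of the door) -/

/-- The mode function `F_n = ½ Im ψ(¼ + iω_n/2) + Σ_k Λ_k k^{−1/2} sin(ω_n log k) − T_n`.
[cite: Yoshida1992HermitianForms, §6 (6.10) p. 303] -/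
noncomputable def modeF (a : ℝ) (n : ℤ) : ℝ :=
  (Complex.digamma (1 / 4 + ((freq a n : ℝ) : ℂ) / 2 * I)).im / 2
    + (∑ k ∈ weilPrimeIndex a, (Λ k : ℝ) / Real.sqrt k * Real.sin (freq a n * Real.log k)) - archExpSumSin a n

/-- Hankel zeta-tail MIDPOINT entry `(1/(e X^e) + 1/(e Y^e))/2` written as in the door (`e, X, Y : ℕ`).
[cite: Yoshida1992HermitianForms, §7 pp. 305–312] -/
noncomputable def hankP (e X Y : ℕ) : ℝ := (1 / ((e : ℝ) * (X : ℝ) ^ e) + 1 / ((e : ℝ) * (Y : ℝ) ^ e)) / 2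

/-- Hankel zeta-tail RADIUS entry `(1/(e X^e) − 1/(e Y^e))/2`. [cite: Yoshida1992HermitianForms, §7 pp. 305–312] -/
noncomputable def hankM (e X Y : ℕ) : ℝ := (1 / ((e : ℝ) * (X : ℝ) ^ e) - 1 / ((e : ℝ) * (Y : ℝ) ^ e)) / 2

/-- **`U₂⁺` of the order-`J` door** (even sector), verbatim with `i, i' : ℕ`.
[cite: Yoshida1992HermitianForms, §7 pp. 305–312] -/
noncomputable def U2EvenJ (a θ η d0 : ℝ) (Be B3e Je : ℕ) (i i' : ℕ) : ℝ :=
  (1 + θ) * (1 + η) * ((π / 4 + (∑ k ∈ weilPrimeIndex a, (Λ k : ℝ) / Real.sqrt k) + a * (1 + weilArchDensity (2 * a)) / (π * B3e)) ^ 2 / (π ^ 2 * d0))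
      * (∑ j ∈ Finset.range Je, ∑ j' ∈ Finset.range Je, (((1 / (((2 * j + 1) + (2 * j' + 1) - 1 : ℕ) * (((B3e - 1 : ℕ) : ℝ)) ^ ((2 * j + 1) + (2 * j' + 1) - 1)) + 1 / (((2 * j + 1) + (2 * j' + 1) - 1 : ℕ) * (B3e : ℝ) ^ ((2 * j + 1) + (2 * j' + 1) - 1))) / 2) + (if j = j' then (∑ j' ∈ Finset.range Je, ((1 / (((2 * j + 1) + (2 * j' + 1) - 1 : ℕ) * (((B3e - 1 : ℕ) : ℝ)) ^ ((2 * j + 1) + (2 * j' + 1) - 1)) - 1 / (((2 * j + 1) + (2 * j' + 1) - 1 : ℕ) * (B3e : ℝ) ^ ((2 * j + 1) + (2 * j' + 1) - 1))) / 2) * (Be : ℝ) ^ (2 * j' + 1) / (Be : ℝ) ^ (2 * j + 1)) else 0)) * ((-1 : ℝ) ^ i * (i : ℝ) ^ (2 * j)) * ((-1 : ℝ) ^ i' * (i' : ℝ) ^ (2 * j')))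
    + (1 + θ) * (1 + η⁻¹) * (1 / d0)
      * (∑ r ∈ Finset.range Je, ∑ r' ∈ Finset.range Je, (((1 / (((2 * r + 2) + (2 * r' + 2) - 1 : ℕ) * (((B3e - 1 : ℕ) : ℝ)) ^ ((2 * r + 2) + (2 * r' + 2) - 1)) + 1 / (((2 * r + 2) + (2 * r' + 2) - 1 : ℕ) * (B3e : ℝ) ^ ((2 * r + 2) + (2 * r' + 2) - 1))) / 2) + (if r = r' then (∑ r' ∈ Finset.range Je, ((1 / (((2 * r + 2) + (2 * r' + 2) - 1 : ℕ) * (((B3e - 1 : ℕ) : ℝ)) ^ ((2 * r + 2) + (2 * r' + 2) - 1)) - 1 / (((2 * r + 2) + (2 * r' + 2) - 1 : ℕ) * (B3e : ℝ) ^ ((2 * r + 2) + (2 * r' + 2) - 1))) / 2) * (Be : ℝ) ^ (2 * r' + 2) / (Be : ℝ) ^ (2 * r + 2)) else 0)) * ((-1 : ℝ) ^ i * (-((i : ℝ) ^ (2 * r + 1)) * ((Complex.digamma (1 / 4 + ((freq a i : ℝ) : ℂ) / 2 * I)).im / 2 + (∑ k ∈ weilPrimeIndex a, (Λ k : ℝ)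 / Real.sqrt k * Real.sin (freq a i * Real.log k)) - archExpSumSin a i) / π + 4 / a * (Real.exp (a / 2) - Real.exp (-(a / 2))) ^ 2 * (-1 : ℝ) ^ r * (a ^ 2 / (4 * π ^ 2)) ^ (r + 1) * (1 / (1 + 4 * freq a i ^ 2)))) * ((-1 : ℝ) ^ i' * (-((i' : ℝ) ^ (2 * r' + 1)) * ((Complex.digamma (1 / 4 + ((freq a i' : ℝ) : ℂ) / 2 * I)).im / 2 + (∑ k ∈ weilPrimeIndex a, (Λ k : ℝ) / Real.sqrt k * Real.sin (freq a i' * Real.log k)) - archExpSumSin a i') / π + 4 / a * (Real.exp (a / 2) - Real.exp (-(a / 2))) ^ 2 * (-1 : ℝ) ^ r' * (a ^ 2 / (4 * π ^ 2)) ^ (r' + 1) * (1 / (1 + 4 * freq a i' ^ 2)))))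
    + (if i = i' then (1 + θ⁻¹) * ((Be : ℝ) / (d0 * ((4 * Je + 1 : ℕ) * (((B3e - 1 : ℕ) : ℝ)) ^ (4 * Je + 1)))) * (2 * (π / 4 + (∑ k ∈ weilPrimeIndex a, (Λ k : ℝ) / Real.sqrt k) + a * (1 + weilArchDensity (2 * a)) / π) * (i : ℝ) ^ (2 * Je) / π + 4 / a * (Real.exp (a / 2) - Real.exp (-(a / 2))) ^ 2 * (a ^ 2 / (4 * π ^ 2)) ^ (Je + 1) * (1 / (1 + 4 * freq a i ^ 2))) ^ 2 else 0)

/-- **Bridge**: the door's inline even tail matrix (indices in `Fin Be`, sums over `Fin Je`) is `U2EvenJ`.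
[cite: Yoshida1992HermitianForms, §7 pp. 305–312] -/
theorem U2EvenJ_fin (a θ η d0 : ℝ) {Be : ℕ} (B3e Je : ℕ) (i i' : Fin Be) :
    ((1 + θ) * (1 + η) * ((π / 4 + (∑ k ∈ weilPrimeIndex a, (Λ k : ℝ) / Real.sqrt k) + a * (1 + weilArchDensity (2 * a)) / (π * B3e)) ^ 2 / (π ^ 2 * d0))
            * (∑ j : Fin Je, ∑ j' : Fin Je, (((1 / (((2 * (j : ℕ) + 1) + (2 * (j' : ℕ) + 1) - 1 : ℕ) * (((B3e - 1 : ℕ) : ℝ)) ^ ((2 * (j : ℕ) + 1) + (2 * (j' : ℕ) + 1) - 1)) + 1 / (((2 * (j : ℕ) + 1) + (2 * (j' : ℕ) + 1) - 1 : ℕ) * (B3e : ℝ) ^ ((2 * (j : ℕ) + 1) + (2 * (j' : ℕ) + 1) - 1))) / 2) + (if j = j' then (∑ j' : Fin Je, ((1 / (((2 * (j : ℕ) + 1) + (2 * (j' : ℕ) + 1) - 1 : ℕ) * (((B3e - 1 : ℕ) : ℝ)) ^ ((2 * (j : ℕ) + 1) + (2 * (j' : ℕ) + 1) - 1)) - 1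 / (((2 * (j : ℕ) + 1) + (2 * (j' : ℕ) + 1) - 1 : ℕ) * (B3e : ℝ) ^ ((2 * (j : ℕ) + 1) + (2 * (j' : ℕ) + 1) - 1))) / 2) * (Be : ℝ) ^ (2 * (j' : ℕ) + 1) / (Be : ℝ) ^ (2 * (j : ℕ) + 1)) else 0)) * ((-1 : ℝ) ^ (i : ℕ) * (i : ℝ) ^ (2 * (j : ℕ))) * ((-1 : ℝ) ^ (i' : ℕ) * (i' : ℝ) ^ (2 * (j' : ℕ))))
          + (1 + θ) * (1 + η⁻¹) * (1 / d0)
            * (∑ r : Fin Je, ∑ r' : Fin Je, (((1 / (((2 * (r : ℕ) + 2) + (2 * (r' : ℕ) + 2) - 1 : ℕ) * (((B3e - 1 : ℕ) : ℝ)) ^ ((2 * (r : ℕ) + 2) + (2 * (r' : ℕ) + 2) - 1)) + 1 / (((2 * (r : ℕ) + 2) + (2 * (r' : ℕ) + 2) - 1 : ℕ) * (B3e : ℝ) ^ ((2 * (r : ℕ) + 2) + (2 * (r' : ℕ) + 2) - 1))) / 2) + (if r = r' then (∑ r' : Fin Je, ((1 / (((2 * (r : ℕ) + 2) + (2 * (r'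 : ℕ) + 2) - 1 : ℕ) * (((B3e - 1 : ℕ) : ℝ)) ^ ((2 * (r : ℕ) + 2) + (2 * (r' : ℕ) + 2) - 1)) - 1 / (((2 * (r : ℕ) + 2) + (2 * (r' : ℕ) + 2) - 1 : ℕ) * (B3e : ℝ) ^ ((2 * (r : ℕ) + 2) + (2 * (r' : ℕ) + 2) - 1))) / 2) * (Be : ℝ) ^ (2 * (r' : ℕ) + 2) / (Be : ℝ) ^ (2 * (r : ℕ) + 2)) else 0)) * ((-1 : ℝ) ^ (i : ℕ) * (-((i : ℝ) ^ (2 * (r : ℕ) + 1)) * ((Complex.digamma (1 / 4 + ((freq a i : ℝ) : ℂ) / 2 * I)).im / 2 + (∑ k ∈ weilPrimeIndex a, (Λ k : ℝ) / Real.sqrt k * Real.sin (freq a i * Real.log k)) - archExpSumSin a i) / π + 4 / a * (Real.exp (a / 2) - Real.exp (-(a / 2))) ^ 2 * (-1 : ℝ) ^ (r : ℕ) * (a ^ 2 / (4 * π ^ 2)) ^ ((r : ℕ) + 1) * (1 / (1 + 4 * freq a i ^ 2)))) * ((-1 : ℝ) ^ (i' : ℕ) * (-((i' : ℝ) ^ (2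 * (r' : ℕ) + 1)) * ((Complex.digamma (1 / 4 + ((freq a i' : ℝ) : ℂ) / 2 * I)).im / 2 + (∑ k ∈ weilPrimeIndex a, (Λ k : ℝ) / Real.sqrt k * Real.sin (freq a i' * Real.log k)) - archExpSumSin a i') / π + 4 / a * (Real.exp (a / 2) - Real.exp (-(a / 2))) ^ 2 * (-1 : ℝ) ^ (r' : ℕ) * (a ^ 2 / (4 * π ^ 2)) ^ ((r' : ℕ) + 1) * (1 / (1 + 4 * freq a i' ^ 2)))))
          + (if i = i' then (1 + θ⁻¹) * ((Be : ℝ) / (d0 * ((4 * Je + 1 : ℕ) * (((B3e - 1 : ℕ) : ℝ)) ^ (4 * Je + 1)))) * (2 * (π / 4 + (∑ k ∈ weilPrimeIndex a, (Λ k : ℝ) / Real.sqrt k) + a * (1 + weilArchDensity (2 * a)) / π) * (i : ℝ) ^ (2 * Je) / π + 4 / a * (Real.exp (a / 2) - Real.exp (-(a / 2))) ^ 2 * (a ^ 2 / (4 * π ^ 2)) ^ (Je + 1) * (1 / (1 + 4 * freq a i ^ 2))) ^ 2 else 0))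
      = U2EvenJ a θ η d0 Be B3e Je i i' := by
  unfold U2EvenJ
  simp only [Finset.sum_range, Fin.val_inj]

/-- **`U₂⁻` of the order-`J` door** (odd sector), verbatim with `k, k' : ℕ` (kernel index `k` = mode `k + 1`).
[cite: Yoshida1992HermitianForms, §7 pp. 305–312] -/
noncomputable def U2OddJ (a θ η d0 : ℝ) (Bo B3o Jo : ℕ) (k k' : ℕ) : ℝ :=
  (1 + θ) * (1 + η) * ((π / 4 + (∑ k ∈ weilPrimeIndex a, (Λ k : ℝ) / Real.sqrt k) + a * (1 + weilArchDensity (2 * a)) / (π * ((B3o : ℝ) + 1))) ^ 2 / (π ^ 2 * d0))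
            * (∑ j ∈ Finset.range Jo, ∑ j' ∈ Finset.range Jo, (((1 / (((2 * j + 2) + (2 * j' + 2) - 1 : ℕ) * (B3o : ℝ) ^ ((2 * j + 2) + (2 * j' + 2) - 1)) + 1 / (((2 * j + 2) + (2 * j' + 2) - 1 : ℕ) * ((B3o + 1 : ℕ) : ℝ) ^ ((2 * j + 2) + (2 * j' + 2) - 1))) / 2) + (if j = j' then (∑ j' ∈ Finset.range Jo, ((1 / (((2 * j + 2) + (2 * j' + 2) - 1 : ℕ) * (B3o : ℝ) ^ ((2 * j + 2) + (2 * j' + 2) - 1)) - 1 / (((2 * j + 2) + (2 * j' + 2) - 1 : ℕ) * ((B3o + 1 : ℕ) : ℝ) ^ ((2 * j + 2) + (2 * j' + 2) - 1))) / 2) * (Bo : ℝ) ^ (2 * j' + 2) / (Bo : ℝ) ^ (2 * j + 2)) else 0)) * ((-1 : ℝ) ^ (k + 1) * ((k : ℝ) + 1) ^ (2 * j + 1)) * ((-1 : ℝ) ^ (k' + 1) * ((k' : ℝ) + 1) ^ (2 * j' + 1)))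
          + (1 + θ) * (1 + η⁻¹) * (1 / d0)
            * (∑ r ∈ Finset.range Jo, ∑ r' ∈ Finset.range Jo, (((1 / (((2 * r + 1) + (2 * r' + 1) - 1 : ℕ) * (B3o : ℝ) ^ ((2 * r + 1) + (2 * r' + 1) - 1)) + 1 / (((2 * r + 1) + (2 * r' + 1) - 1 : ℕ) * ((B3o + 1 : ℕ) : ℝ) ^ ((2 * r + 1) + (2 * r' + 1) - 1))) / 2) + (if r = r' then (∑ r' ∈ Finset.range Jo, ((1 / (((2 * r + 1) + (2 * r' + 1) - 1 : ℕ) * (B3o : ℝ) ^ ((2 * r + 1) + (2 * r' + 1) - 1)) - 1 / (((2 * r + 1) + (2 * r' + 1) - 1 : ℕ) * ((B3o + 1 : ℕ) : ℝ) ^ ((2 * r + 1) + (2 * r' + 1) - 1))) / 2) * (Bo : ℝ) ^ (2 * r' + 1) / (Bo : ℝ) ^ (2 * r + 1)) else 0)) * ((-1 : ℝ) ^ (k + 1) * (-(((k : ℝ) + 1) ^ (2 * r)) * ((Complex.digamma (1 / 4 + ((freq a ((k : ℤ) + 1) : ℝ) : ℂ) / 2 * I)).im / 2 + (∑ p ∈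 weilPrimeIndex a, (Λ p : ℝ) / Real.sqrt p * Real.sin (freq a ((k : ℤ) + 1) * Real.log p)) - archExpSumSin a ((k : ℤ) + 1)) / π - 4 * (Real.exp (a / 2) - Real.exp (-(a / 2))) ^ 2 / π * (-1 : ℝ) ^ r * (a ^ 2 / (4 * π ^ 2)) ^ r * (freq a ((k : ℤ) + 1) / (1 + 4 * freq a ((k : ℤ) + 1) ^ 2)))) * ((-1 : ℝ) ^ (k' + 1) * (-(((k' : ℝ) + 1) ^ (2 * r')) * ((Complex.digamma (1 / 4 + ((freq a ((k' : ℤ) + 1) : ℝ) : ℂ) / 2 * I)).im / 2 + (∑ p ∈ weilPrimeIndex a, (Λ p : ℝ) / Real.sqrt p * Real.sin (freq a ((k' : ℤ) + 1) * Real.log p)) - archExpSumSin a ((k' : ℤ) + 1)) / π - 4 * (Real.exp (a / 2) - Real.exp (-(a / 2))) ^ 2 / π * (-1 : ℝ) ^ r' * (a ^ 2 / (4 * π ^ 2)) ^ r' * (freq a ((k' : ℤ) + 1) / (1 + 4 * freq a ((k' : ℤ) + 1) ^ 2)))))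
          + (if k = k' then (1 + θ⁻¹) * ((Bo : ℝ) / (d0 * ((4 * Jo + 1 : ℕ) * (B3o : ℝ) ^ (4 * Jo + 1)))) * (2 * (π / 4 + (∑ k ∈ weilPrimeIndex a, (Λ k : ℝ) / Real.sqrt k) + a * (1 + weilArchDensity (2 * a)) / π) * ((k : ℝ) + 1) ^ (2 * Jo) / π + 4 * (Real.exp (a / 2) - Real.exp (-(a / 2))) ^ 2 / π * (a ^ 2 / (4 * π ^ 2)) ^ Jo * (freq a ((k : ℤ) + 1) / (1 + 4 * freq a ((k : ℤ) + 1) ^ 2))) ^ 2 else 0)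

/-- **Bridge**: the door's inline odd tail matrix (indices in `Fin Bo`, sums over `Fin Jo`) is `U2OddJ`.
[cite: Yoshida1992HermitianForms, §7 pp. 305–312] -/
theorem U2OddJ_fin (a θ η d0 : ℝ) {Bo : ℕ} (B3o Jo : ℕ) (k k' : Fin Bo) :
    ((1 + θ) * (1 + η) * ((π / 4 + (∑ k ∈ weilPrimeIndex a, (Λ k : ℝ) / Real.sqrt k) + a * (1 + weilArchDensity (2 * a)) / (π * ((B3o : ℝ) + 1))) ^ 2 / (π ^ 2 * d0))
            * (∑ j : Fin Jo, ∑ j' : Fin Jo, (((1 / (((2 * (j : ℕ) + 2) + (2 * (j' : ℕ) + 2) - 1 : ℕ) * (B3o : ℝ) ^ ((2 * (j : ℕ) + 2) + (2 * (j' : ℕ) + 2) - 1)) + 1 / (((2 * (j : ℕ) + 2) + (2 * (j' : ℕ) + 2) - 1 : ℕ) * ((B3o + 1 : ℕ) : ℝ) ^ ((2 * (j : ℕ) + 2) + (2 * (j' : ℕ) + 2) - 1))) / 2) + (if j = j' then (∑ j' : Fin Jo, ((1 / (((2 * (j : ℕ) + 2) + (2 * (j' : ℕ) + 2) - 1 :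 ℕ) * (B3o : ℝ) ^ ((2 * (j : ℕ) + 2) + (2 * (j' : ℕ) + 2) - 1)) - 1 / (((2 * (j : ℕ) + 2) + (2 * (j' : ℕ) + 2) - 1 : ℕ) * ((B3o + 1 : ℕ) : ℝ) ^ ((2 * (j : ℕ) + 2) + (2 * (j' : ℕ) + 2) - 1))) / 2) * (Bo : ℝ) ^ (2 * (j' : ℕ) + 2) / (Bo : ℝ) ^ (2 * (j : ℕ) + 2)) else 0)) * ((-1 : ℝ) ^ ((k : ℕ) + 1) * (((k : ℕ) : ℝ) + 1) ^ (2 * (j : ℕ) + 1)) * ((-1 : ℝ) ^ ((k' : ℕ) + 1) * (((k' : ℕ) : ℝ) + 1) ^ (2 * (j' : ℕ) + 1)))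
          + (1 + θ) * (1 + η⁻¹) * (1 / d0)
            * (∑ r : Fin Jo, ∑ r' : Fin Jo, (((1 / (((2 * (r : ℕ) + 1) + (2 * (r' : ℕ) + 1) - 1 : ℕ) * (B3o : ℝ) ^ ((2 * (r : ℕ) + 1) + (2 * (r' : ℕ) + 1) - 1)) + 1 / (((2 * (r : ℕ) + 1) + (2 * (r' : ℕ) + 1) - 1 : ℕ) * ((B3o + 1 : ℕ) : ℝ) ^ ((2 * (r : ℕ) + 1) + (2 * (r' : ℕ) + 1) - 1))) / 2) + (if r = r' then (∑ r' : Fin Jo, ((1 / (((2 * (r : ℕ) + 1) + (2 * (r' : ℕ) + 1) - 1 : ℕ) * (B3o : ℝ) ^ ((2 * (r : ℕ) + 1) + (2 * (r' : ℕ) + 1) - 1)) - 1 / (((2 * (r : ℕ) + 1) + (2 * (r' : ℕ) + 1) - 1 : ℕ) * ((B3o + 1 : ℕ) : ℝ) ^ ((2 * (r : ℕ) + 1) + (2 * (r' : ℕ) + 1) - 1))) / 2) * (Bo : ℝ) ^ (2 * (r' : ℕ) + 1) / (Bo : ℝ) ^ (2 * (r : ℕ) + 1)) else 0)) * ((-1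 : ℝ) ^ ((k : ℕ) + 1) * (-((((k : ℕ) : ℝ) + 1) ^ (2 * (r : ℕ))) * ((Complex.digamma (1 / 4 + ((freq a (((k : ℕ) : ℤ) + 1) : ℝ) : ℂ) / 2 * I)).im / 2 + (∑ p ∈ weilPrimeIndex a, (Λ p : ℝ) / Real.sqrt p * Real.sin (freq a (((k : ℕ) : ℤ) + 1) * Real.log p)) - archExpSumSin a (((k : ℕ) : ℤ) + 1)) / π - 4 * (Real.exp (a / 2) - Real.exp (-(a / 2))) ^ 2 / π * (-1 : ℝ) ^ (r : ℕ) * (a ^ 2 / (4 * π ^ 2)) ^ (r : ℕ) * (freq a (((k : ℕ) : ℤ) + 1) / (1 + 4 * freq a (((k : ℕ) : ℤ) + 1) ^ 2)))) * ((-1 : ℝ) ^ ((k' : ℕ) + 1) * (-((((k' : ℕ) : ℝ) + 1) ^ (2 * (r' : ℕ))) * ((Complex.digamma (1 / 4 + ((freq a (((k' : ℕ) : ℤ) + 1) : ℝ) : ℂ) / 2 * I)).im / 2 + (∑ p ∈ weilPrimeIndex a, (Λ p : ℝ) / Real.sqrt p * Real.sin (freq a (((k' : ℕ) : ℤ) +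 1) * Real.log p)) - archExpSumSin a (((k' : ℕ) : ℤ) + 1)) / π - 4 * (Real.exp (a / 2) - Real.exp (-(a / 2))) ^ 2 / π * (-1 : ℝ) ^ (r' : ℕ) * (a ^ 2 / (4 * π ^ 2)) ^ (r' : ℕ) * (freq a (((k' : ℕ) : ℤ) + 1) / (1 + 4 * freq a (((k' : ℕ) : ℤ) + 1) ^ 2)))))
          + (if k = k' then (1 + θ⁻¹) * ((Bo : ℝ) / (d0 * ((4 * Jo + 1 : ℕ) * (B3o : ℝ) ^ (4 * Jo + 1)))) * (2 * (π / 4 + (∑ k ∈ weilPrimeIndex a, (Λ k : ℝ) / Real.sqrt k) + a * (1 + weilArchDensity (2 * a)) / π) * (((k : ℕ) : ℝ) + 1) ^ (2 * Jo) / π + 4 * (Real.exp (a / 2) - Real.exp (-(a / 2))) ^ 2 / π * (a ^ 2 / (4 * π ^ 2)) ^ Jo * (freq a (((k : ℕ) : ℤ) + 1) / (1 + 4 * freq a (((k : ℕ) : ℤ) + 1) ^ 2))) ^ 2 else 0))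
      = U2OddJ a θ η d0 Bo B3o Jo k k' := by
  unfold U2OddJ
  simp only [Finset.sum_range, Fin.val_inj]


/-! ## Structured form of `U₂⁺` (atoms) and its identification with the verbatim one -/

/-- `C_F = π/4 + A₁ + a(1+E)/π` (sup of `|F_m|`). [cite: Yoshida1992HermitianForms, §7 pp. 305–312] -/
noncomputable def cF (a : ℝ) : ℝ := π / 4 + primeMass a + a * (1 + weilArchDensity (2 * a)) / π

/-- `C_A⁺ = π/4 + A₁ + a(1+E)/(πB₃)` (sup of `|F_m|` on the even tail). [cite: Yoshida1992HermitianForms, §7 pp. 305–312] -/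
noncomputable def cAe (a : ℝ) (B3e : ℕ) : ℝ := π / 4 + primeMass a + a * (1 + weilArchDensity (2 * a)) / (π * B3e)

/-- `q = a²/(4π²)`. [cite: Yoshida1992HermitianForms, §7 pp. 305–312] -/
noncomputable def qq (a : ℝ) : ℝ := a ^ 2 / (4 * π ^ 2)

/-- `s² = (e^{a/2} − e^{−a/2})²`. [cite: Yoshida1992HermitianForms, §7 pp. 305–312] -/
noncomputable def s2r (a : ℝ) : ℝ := (Real.exp (a / 2) - Real.exp (-(a / 2))) ^ 2

/-- `c_n = 1/(1 + 4ω_n²)`. [cite: Yoshida1992HermitianForms, §7 pp. 305–312] -/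
noncomputable def ccoef (a : ℝ) (n : ℤ) : ℝ := 1 / (1 + 4 * freq a n ^ 2)

/-- even A-family exponent `2j + 1`. [cite: Yoshida1992HermitianForms, §7 pp. 305–312] -/
def pA (j : ℕ) : ℕ := 2 * j + 1

/-- even B-family exponent `2r + 2`. [cite: Yoshida1992HermitianForms, §7 pp. 305–312] -/
def pB (r : ℕ) : ℕ := 2 * r + 2

/-- Hankel Gram entry with the Gershgorin radius on the diagonal (exponent map `p`, weights `B^{p}`).
[cite: Yoshida1992HermitianForms, §7 pp. 305–312] -/
noncomputable def hankH (p : ℕ → ℕ) (X Y B Je : ℕ) (j j' : ℕ) : ℝ :=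
  hankP (p j + p j' - 1) X Y
    + (if j = j' then (∑ j' ∈ Finset.range Je, hankM (p j + p j' - 1) X Y * (B : ℝ) ^ (p j') / (B : ℝ) ^ (p j)) else 0)

/-- `v^A_j(i) = (−1)^i i^{2j}`. [cite: Yoshida1992HermitianForms, §7 pp. 305–312] -/
noncomputable def vAe (i j : ℕ) : ℝ := (-1 : ℝ) ^ i * (i : ℝ) ^ (2 * j)

/-- `v^B_r(i) = (−1)^i(−i^{2r+1}F_i/π + (4/a)s²(−1)^r q^{r+1}c_i)`. [cite: Yoshida1992HermitianForms, §7 pp. 305–312] -/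
noncomputable def vBe (a : ℝ) (i r : ℕ) : ℝ :=
  (-1 : ℝ) ^ i * (-((i : ℝ) ^ (2 * r + 1)) * modeF a i / π + 4 / a * s2r a * (-1 : ℝ) ^ r * qq a ^ (r + 1) * ccoef a i)

/-- `ρ⁺_i = 2C_F i^{2J}/π + (4/a)s² q^{J+1} c_i`. [cite: Yoshida1992HermitianForms, §7 pp. 305–312] -/
noncomputable def rhoE (a : ℝ) (Je i : ℕ) : ℝ := 2 * cF a * (i : ℝ) ^ (2 * Je) / π + 4 / a * s2r a * qq a ^ (Je + 1) * ccoef a i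

/-- Structured `U₂⁺`. [cite: Yoshida1992HermitianForms, §7 pp. 305–312] -/
noncomputable def U2EvenJ' (a θ η d0 : ℝ) (Be B3e Je : ℕ) (i i' : ℕ) : ℝ :=
  (1 + θ) * (1 + η) * (cAe a B3e ^ 2 / (π ^ 2 * d0))
      * (∑ j ∈ Finset.range Je, ∑ j' ∈ Finset.range Je, hankH pA (B3e - 1) B3e Be Je j j' * vAe i j * vAe i' j')
    + (1 + θ) * (1 + η⁻¹) * (1 / d0)
      * (∑ r ∈ Finset.range Je, ∑ r' ∈ Finset.range Je, hankH pB (B3e - 1) B3e Be Je r r' * vBe a i r * vBe a i' r')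
    + (if i = i' then (1 + θ⁻¹) * ((Be : ℝ) / (d0 * ((4 * Je + 1 : ℕ) * (((B3e - 1 : ℕ) : ℝ)) ^ (4 * Je + 1)))) * rhoE a Je i ^ 2 else 0)

/-- The structured form is the verbatim one. [cite: Yoshida1992HermitianForms, §7 pp. 305–312] -/
theorem U2EvenJ'_eq (a θ η d0 : ℝ) (Be B3e Je : ℕ) (i i' : ℕ) :
    U2EvenJ' a θ η d0 Be B3e Je i i' = U2EvenJ a θ η d0 Be B3e Je i i' := by
  simp only [U2EvenJ', U2EvenJ, hankH, hankP, hankM, pA, pB, vAe, vBe, rhoE, cF, cAe, qq, s2r, ccoef, modeF, primeMass]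


/-! ## Structured form of `U₂⁻` (atoms), its identification and its box -/

/-- `C_A⁻ = π/4 + A₁ + a(1+E)/(π(B₃+1))`. [cite: Yoshida1992HermitianForms, §7 pp. 305–312] -/
noncomputable def cAo (a : ℝ) (B3o : ℕ) : ℝ := π / 4 + primeMass a + a * (1 + weilArchDensity (2 * a)) / (π * ((B3o : ℝ) + 1))

/-- `ω_n c_n = ω_n/(1 + 4ω_n²)`. [cite: Yoshida1992HermitianForms, §7 pp. 305–312] -/
noncomputable def wcoef (a : ℝ) (n : ℤ) : ℝ := freq a n / (1 + 4 * freq a n ^ 2)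

/-- odd A-family exponent `2j + 2`. [cite: Yoshida1992HermitianForms, §7 pp. 305–312] -/
def pOA (j : ℕ) : ℕ := 2 * j + 2

/-- odd B-family exponent `2r + 1`. [cite: Yoshida1992HermitianForms, §7 pp. 305–312] -/
def pOB (r : ℕ) : ℕ := 2 * r + 1

/-- `v^A_j(k) = (−1)^{k+1}(k+1)^{2j+1}` (odd). [cite: Yoshida1992HermitianForms, §7 pp. 305–312] -/
noncomputable def vAo (k j : ℕ) : ℝ := (-1 : ℝ) ^ (k + 1) * ((k : ℝ) + 1) ^ (2 * j + 1)

/-- `v^B_r(k)` (odd). [cite: Yoshida1992HermitianForms, §7 pp. 305–312] -/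
noncomputable def vBo (a : ℝ) (k r : ℕ) : ℝ :=
  (-1 : ℝ) ^ (k + 1) * (-(((k : ℝ) + 1) ^ (2 * r)) * modeF a ((k : ℤ) + 1) / π
    - 4 * s2r a / π * (-1 : ℝ) ^ r * qq a ^ r * wcoef a ((k : ℤ) + 1))

/-- `ρ⁻_k` (odd). [cite: Yoshida1992HermitianForms, §7 pp. 305–312] -/
noncomputable def rhoO (a : ℝ) (Jo k : ℕ) : ℝ :=
  2 * cF a * ((k : ℝ) + 1) ^ (2 * Jo) / π + 4 * s2r a / π * qq a ^ Jo * wcoef a ((k : ℤ) + 1)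

/-- Structured `U₂⁻`. [cite: Yoshida1992HermitianForms, §7 pp. 305–312] -/
noncomputable def U2OddJ' (a θ η d0 : ℝ) (Bo B3o Jo : ℕ) (k k' : ℕ) : ℝ :=
  (1 + θ) * (1 + η) * (cAo a B3o ^ 2 / (π ^ 2 * d0))
      * (∑ j ∈ Finset.range Jo, ∑ j' ∈ Finset.range Jo, hankH pOA B3o (B3o + 1) Bo Jo j j' * vAo k j * vAo k' j')
    + (1 + θ) * (1 + η⁻¹) * (1 / d0)
      * (∑ r ∈ Finset.range Jo, ∑ r' ∈ Finset.range Jo, hankH pOB B3o (B3o + 1) Bo Jo r r' * vBo a k r * vBo a k' r')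
    + (if k = k' then (1 + θ⁻¹) * ((Bo : ℝ) / (d0 * ((4 * Jo + 1 : ℕ) * (B3o : ℝ) ^ (4 * Jo + 1)))) * rhoO a Jo k ^ 2 else 0)

/-- The structured form is the verbatim one. [cite: Yoshida1992HermitianForms, §7 pp. 305–312] -/
theorem U2OddJ'_eq (a θ η d0 : ℝ) (Bo B3o Jo : ℕ) (k k' : ℕ) :
    U2OddJ' a θ η d0 Bo B3o Jo k k' = U2OddJ a θ η d0 Bo B3o Jo k k' := by
  simp only [U2OddJ', U2OddJ, hankH, hankP, hankM, pOA, pOB, vAo, vBo, rhoO, cF, cAo, qq, s2r, wcoef, modeF, primeMass]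

end Encl

end Literature.NumberTheory.LFunctions.Yoshida1992
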